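import Summits.CriticalPhenomena.Ising3D.IsingColumnFaceL11CensusDistinctAssembly
import Summits.CriticalPhenomena.Ising3D.IsingColumnFaceL11CensusSegmentLinC

/-!
# The catalogue census of §7.3 as kernel facts, IX: the distinct-values machine, part 6 — the `LIN` theorems: the
description counts of §7.3 are VALUE counts; the sharp minimum separation (cell `pub-ising3x`, seat recog-1;
paper §1.6 / §7.3)

HONEST FRAMING: lottery ticket; floor = tightest certified 3D Ising CFT bounds; no exact-solution
claim without a proof. Island framing: certified exclusion region at stated derivative order and
assumptions; not a determination of the 3D Ising critical exponents beyond that.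

§7.3 prints «short linear forms in classical constants 30 105 / 43 907 / 38 648 (kernel: `lin_descr_subwindow_ncard` —
primitive tuples `(a₀, c, aₓ)`; 112 660 on the whole segment)». Here:
* `exists_prim_of_linTupleOK` — every tuple of the table has a PRIMITIVE tuple with the same value (divide by the gcd), so
  every member of `linFamily 12` is the value of a primitive description;
* **`lin_value_injOn`** — on the certified segment `[81/64, 2855/2048]` the map description ↦ value is injective on
  primitive descriptions (from `tup_separated`: two distinct ones are `≥ dL/distU > 0` apart);
* **`lin_values_subwindow_ncard`** / **`lin_values_segment_ncard`** — hence the description counts ARE value counts: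
  `linFamily 12` has exactly `30105 / 43907 / 38648` distinct VALUES in the three closed sub-windows and `112660` in
  the segment;
* **`lin_min_separation`** — any two distinct `LIN` values in the segment differ by at least `dL/distU`
  (`≥ 43966·10⁻¹⁶`), and **`lin_min_separation_attained`** — the members `(175 − 5π³ − 11ζ(3))/5` and
  `(48 − 11π + 3G)/12` differ by at most `45983·10⁻¹⁶`: the minimum separation of the table on the segment is
  `4.39…4.60·10⁻¹²` (bracket width = the landed `ζ(3)` enclosure).
No relation-freeness among `π, log 2, ζ(3), ζ(5), G` is assumed: the statement is decided for this finite table on this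
segment by the certified enclosures. ONE enclosure table on the `LIN` side: these `LIN`-only theorems run, like the cross-table
ones, on `kZT` / `linZEnclT` (the landed `kZ` / `linZEncl` with `log 2` at twenty digits from the landed `LogTwoBounds`); they would
also certify at the landed ten digits (the attaining pair carries no `log 2`), but the machine keeps one table. A statement about
the catalogue, NOT about `Δε`; nothing is recognised (§1.6).
lottery ticket; floor = tightest certified 3D Ising CFT bounds; no exact-solution claim without a proof.
-/

namespace Summit.CriticalPhenomena.Ising3D
namespace ColumnFaceL11
open Set Literature.MathematicalPhysics.QuantumFieldTheory.ConformalBootstrap3D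

/-! ### Every description has a primitive description with the same value -/

/-- `gcdList c` divides every entry of `c`. [folklore] -/
theorem gcdList_dvd : ∀ (c : List ℤ) (y : ℤ), y ∈ c → ((gcdList c : ℕ) : ℤ) ∣ y
  | [], y, h => by simp at h
  | z :: zs, y, h => by
      rcases List.mem_cons.mp h with rfl | h
      · exact Int.natCast_dvd.mpr (Nat.gcd_dvd_left _ _)
      · exact dvd_trans (Int.natCast_dvd_natCast.mpr (Nat.gcd_dvd_right _ _)) (gcdList_dvd zs y h)

/-- Dividing every entry by a common divisor `g` divides `gcdList` by `g`. [folklore] -/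
theorem gcdList_map_div {g : ℕ} : ∀ (c : List ℤ), g ∣ gcdList c → gcdList (c.map (· / (g : ℤ))) = gcdList c / g
  | [], _ => by simp [gcdList]
  | z :: zs, h => by
      have hz : g ∣ z.natAbs := dvd_trans h (Nat.gcd_dvd_left _ _)
      have hzs : g ∣ gcdList zs := dvd_trans h (Nat.gcd_dvd_right _ _)
      have hz' : (g : ℤ) ∣ z := Int.natCast_dvd.mpr hz
      simp only [List.map_cons, gcdList]
      rw [gcdList_map_div zs hzs, Int.natAbs_ediv_of_dvd hz', Int.natAbs_natCast, Nat.gcd_div hz hzs]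

/-- **Primitive representative.** Every tuple of the table `linFamily 12` has a PRIMITIVE tuple of the table with the same
value (divide `a₀`, `c`, `aₓ` by their gcd). [folklore] -/
theorem exists_prim_of_linTupleOK {e : ℤ × List ℤ × ℕ} (hok : linTupleOK 12 e = true) :
    ∃ e' : ℤ × List ℤ × ℕ, linTupleOK 12 e' = true ∧ linPrim e' = true ∧ lin7TupleVal e' = lin7TupleVal e := by
  obtain ⟨a0, c, ax⟩ := e
  have hok' := hok
  simp only [linTupleOK, Bool.and_eq_true, decide_eq_true_eq, List.all_eq_true] at hok'
  obtain ⟨⟨⟨⟨⟨hlen, h1⟩, h2⟩, hb⟩, hf⟩, hne⟩ := hok'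
  set G := gcdList c with hG
  set g := Nat.gcd (Nat.gcd a0.natAbs ax) G with hg
  have hg0 : 0 < g := by
    rw [hg]; apply Nat.pos_of_ne_zero; intro h0
    have := (Nat.gcd_eq_zero_iff.mp (Nat.gcd_eq_zero_iff.mp h0).1).2
    omega
  have hga0 : (g : ℤ) ∣ a0 := Int.natCast_dvd.mpr (dvd_trans (Nat.gcd_dvd_left _ _) (Nat.gcd_dvd_left _ _))
  have hgax : g ∣ ax := dvd_trans (Nat.gcd_dvd_left _ _) (Nat.gcd_dvd_right _ _)
  have hgG : g ∣ G := Nat.gcd_dvd_right _ _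
  have hgy : ∀ y ∈ c, (g : ℤ) ∣ y := fun y hy => dvd_trans (Int.natCast_dvd_natCast.mpr hgG) (gcdList_dvd c y hy)
  have hgR : (g : ℝ) ≠ 0 := by exact_mod_cast hg0.ne'
  have hgZ : (g : ℤ) ≠ 0 := by exact_mod_cast hg0.ne'
  set c' := c.map (· / (g : ℤ)) with hc'
  -- the non-zero pattern is unchanged
  have hfilt : c'.filter (· ≠ 0) = (c.filter (· ≠ 0)).map (· / (g : ℤ)) := by
    rw [hc', List.filter_map]
    congr 1
    apply List.filter_congr
    intro y hy
    have hdiv := Int.ediv_mul_cancel (hgy y hy)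
    by_cases hy0 : y = 0
    · subst hy0; simp
    · have : y / (g : ℤ) ≠ 0 := by
        intro h0; rw [h0, zero_mul] at hdiv; exact hy0 hdiv.symm
      simp [Function.comp, hy0, this]
  refine ⟨(a0 / g, c', ax / g), ?_, ?_, ?_⟩
  · simp only [linTupleOK, Bool.and_eq_true, decide_eq_true_eq, List.all_eq_true]
    refine ⟨⟨⟨⟨⟨by rw [hc', List.length_map, hlen], Nat.div_pos (Nat.le_of_dvd (by omega) hgax) hg0⟩,
      (Nat.div_le_self _ _).trans h2⟩, ?_⟩, ?_⟩, ?_⟩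
    · intro y' hy'
      rw [hc', List.mem_map] at hy'
      obtain ⟨y, hy, rfl⟩ := hy'
      obtain ⟨hy1, hy2⟩ := hb y hy
      have habs : (y / (g : ℤ)).natAbs ≤ y.natAbs := by
        rw [Int.natAbs_ediv_of_dvd (hgy y hy), Int.natAbs_natCast]; exact Nat.div_le_self _ _
      constructor <;> omega
    · rw [hfilt, List.length_map]; exact hf
    · intro h0
      have hnil : c'.filter (· ≠ 0) = [] := by rw [h0]; decide
      rw [hfilt, List.map_eq_nil_iff, List.filter_eq_nil_iff] at hnil
      apply hne
      have hall : ∀ y ∈ c, y = 0 := fun y hy => by simpa using hnil y hy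
      have := List.eq_replicate_of_mem hall
      rw [hlen] at this
      exact this
  · simp only [linPrim, beq_iff_eq]
    rw [hc', gcdList_map_div c hgG, Int.natAbs_ediv_of_dvd hga0, Int.natAbs_natCast,
      Nat.gcd_div (dvd_trans (Nat.gcd_dvd_left _ _) (Nat.gcd_dvd_left _ _)) hgax, Nat.gcd_div (Nat.gcd_dvd_left _ _) hgG]
    exact Nat.div_self hg0
  · -- the value: (a₀/g + L/g)/(aₓ/g) = (a₀ + L)/aₓ
    have hmul : c'.map (· * (g : ℤ)) = c.map (· * (1 : ℤ)) := by
      rw [hc', List.map_map]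
      apply List.map_congr_left
      intro y hy
      show y / (g : ℤ) * (g : ℤ) = y * 1
      rw [Int.ediv_mul_cancel (hgy y hy), mul_one]
    have hL := lin7Val_mul_eq 0 c' c hmul
    have hax0 : (0 : ℝ) < ax := by exact_mod_cast h1
    unfold lin7TupleVal
    simp only
    rw [Int.cast_div hga0 (by exact_mod_cast hgZ), Nat.cast_div hgax hgR, Int.cast_natCast]
    have hL' : lin7Val 0 c' = lin7Val 0 c / g := by
      rw [eq_div_iff hgR]; simpa using hL
    rw [hL']
    field_simp

/-- Every member of `linFamily 12` is the value of a primitive description. [folklore] -/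
theorem exists_prim_of_mem_linFamily {x : ℝ} (hx : x ∈ linFamily 12) :
    ∃ e : ℤ × List ℤ × ℕ, linTupleOK 12 e = true ∧ linPrim e = true ∧ x = lin7TupleVal e := by
  obtain ⟨a0, c, ax, hlen, h1, h2, hb, hf, hne, rfl⟩ := hx
  have hok : linTupleOK 12 (a0, c, ax) = true := by
    simp only [linTupleOK, Bool.and_eq_true, decide_eq_true_eq, List.all_eq_true]
    exact ⟨⟨⟨⟨⟨hlen, h1⟩, h2⟩, fun y hy => hb y hy⟩, hf⟩, hne⟩
  obtain ⟨e', hok', hprim', hval⟩ := exists_prim_of_linTupleOK hok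
  exact ⟨e', hok', hprim', hval.symm⟩

/-! ### Injectivity, value counts, minimum separation -/

/-- **Injectivity of description ↦ value** on primitive descriptions with value in the certified segment. [folklore] -/
theorem lin_value_injOn : Set.InjOn lin7TupleVal
    {e : ℤ × List ℤ × ℕ | linTupleOK 12 e = true ∧ linPrim e = true ∧
      (81 / 64 : ℝ) ≤ lin7TupleVal e ∧ lin7TupleVal e ≤ 2855 / 2048} := by
  intro e he e' he' hv
  obtain ⟨hok, hprim, h1, h2⟩ := he
  obtain ⟨hok', hprim', h1', h2'⟩ := he'
  by_contra hne
  have hsep := lin_descr_separated hok hprim hok' hprim' hne h1 h2 h1' h2'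
  rw [hv, sub_self, abs_zero] at hsep
  linarith [dL_div_pos]

/-- **Minimum separation of `LIN` values on the segment**: two distinct members of `linFamily 12` in
`[81/64, 2855/2048]` differ by at least `dL/distU = 4.3966…·10⁻¹²`. [folklore] -/
theorem lin_min_separation {x y : ℝ} (hx : x ∈ linFamily 12) (hy : y ∈ linFamily 12)
    (hx1 : (81 / 64 : ℝ) ≤ x) (hx2 : x ≤ 2855 / 2048) (hy1 : (81 / 64 : ℝ) ≤ y) (hy2 : y ≤ 2855 / 2048)
    (hne : x ≠ y) : (dL : ℝ) / distU ≤ |x - y| := by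
  obtain ⟨e, hok, hprim, rfl⟩ := exists_prim_of_mem_linFamily hx
  obtain ⟨e', hok', hprim', rfl⟩ := exists_prim_of_mem_linFamily hy
  have hne' : e ≠ e' := by
    intro h; apply hne; rw [h]
  exact lin_descr_separated hok hprim hok' hprim' hne' hx1 hx2 hy1 hy2

/-- Decimal form: distinct `LIN` values on the segment differ by more than `43966·10⁻¹⁶`. [folklore] -/
theorem lin_min_separation_decimal {x y : ℝ} (hx : x ∈ linFamily 12) (hy : y ∈ linFamily 12)
    (hx1 : (81 / 64 : ℝ) ≤ x) (hx2 : x ≤ 2855 / 2048) (hy1 : (81 / 64 : ℝ) ≤ y) (hy2 : y ≤ 2855 / 2048)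
    (hne : x ≠ y) : (43966 : ℝ) / 10 ^ 16 ≤ |x - y| := by
  refine le_trans ?_ (lin_min_separation hx hy hx1 hx2 hy1 hy2 hne)
  rw [div_le_div_iff₀ (by norm_num) distU_pos.1]
  unfold dL distU linS lcm32; norm_num

/-- The members of `linFamily 12` in a closed window are exactly the values of the primitive descriptions with value
there. [folklore] -/
theorem lin_values_eq_image (lo hi : ℝ) :
    linFamily 12 ∩ Set.Icc lo hi = lin7TupleVal ''
      {e : ℤ × List ℤ × ℕ | linTupleOK 12 e = true ∧ linPrim e = true ∧ lo ≤ lin7TupleVal e ∧ lin7TupleVal e ≤ hi} := by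
  ext x
  constructor
  · rintro ⟨hx, h1, h2⟩
    obtain ⟨e, hok, hprim, rfl⟩ := exists_prim_of_mem_linFamily hx
    exact ⟨e, ⟨hok, hprim, h1, h2⟩, rfl⟩
  · rintro ⟨e, ⟨hok, -, h1, h2⟩, rfl⟩
    exact ⟨mem_linFamily_of_linTupleOK hok, h1, h2⟩

/-- Counting values in a window inside the segment = counting primitive descriptions. [folklore] -/
theorem lin_values_ncard_eq {lo hi : ℝ} (hlo : (81 / 64 : ℝ) ≤ lo) (hhi : hi ≤ 2855 / 2048) :
    (linFamily 12 ∩ Set.Icc lo hi).ncard =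
      {e : ℤ × List ℤ × ℕ | linTupleOK 12 e = true ∧ linPrim e = true ∧ lo ≤ lin7TupleVal e ∧
        lin7TupleVal e ≤ hi}.ncard := by
  rw [lin_values_eq_image]
  apply Set.InjOn.ncard_image
  refine Set.InjOn.mono (fun e he => ?_) lin_value_injOn
  simp only [Set.mem_setOf_eq] at he ⊢
  exact ⟨he.1, he.2.1, hlo.trans he.2.2.1, he.2.2.2.trans hhi⟩

/-- **The §7.3 `LIN` census numbers are VALUE counts**: `linFamily 12` has exactly `30105`, `43907`, `38648` distinct
values in the closed sub-windows `[81/64, 13/10]`, `[13/10, 27/20]`, `[27/20, 2855/2048]` (the description counts of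
`lin_descr_subwindow_ncard`, now known to be counts of distinct reals). [folklore] -/
theorem lin_values_subwindow_ncard :
    (linFamily 12 ∩ Set.Icc (81 / 64 : ℝ) (13 / 10)).ncard = 30105 ∧
    (linFamily 12 ∩ Set.Icc (13 / 10 : ℝ) (27 / 20)).ncard = 43907 ∧
    (linFamily 12 ∩ Set.Icc (27 / 20 : ℝ) (2855 / 2048)).ncard = 38648 := by
  obtain ⟨h0, h1, h2⟩ := lin_descr_subwindow_ncard
  have c0 : ((segCutQ 0 : ℚ) : ℝ) = 81 / 64 := by norm_num [segCutQ]
  have c1 : ((segCutQ 1 : ℚ) : ℝ) = 13 / 10 := by norm_num [segCutQ]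
  have c2 : ((segCutQ 2 : ℚ) : ℝ) = 27 / 20 := by norm_num [segCutQ]
  have c3 : ((segCutQ 3 : ℚ) : ℝ) = 2855 / 2048 := by norm_num [segCutQ]
  rw [c0, c1] at h0; rw [c1, c2] at h1; rw [c2, c3] at h2
  refine ⟨?_, ?_, ?_⟩
  · rw [lin_values_ncard_eq (by norm_num) (by norm_num)]; exact h0
  · rw [lin_values_ncard_eq (by norm_num) (by norm_num)]; exact h1
  · rw [lin_values_ncard_eq (by norm_num) (by norm_num)]; exact h2

/-- **On the whole certified segment: `linFamily 12` has exactly `112660` distinct values.** [folklore] -/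
theorem lin_values_segment_ncard : (linFamily 12 ∩ Set.Icc (81 / 64 : ℝ) (2855 / 2048)).ncard = 112660 := by
  have h := lin_descr_segment_ncard
  have c0 : ((segCutQ 0 : ℚ) : ℝ) = 81 / 64 := by norm_num [segCutQ]
  have c3 : ((segCutQ 3 : ℚ) : ℝ) = 2855 / 2048 := by norm_num [segCutQ]
  rw [c0, c3] at h
  rw [lin_values_ncard_eq (by norm_num) (by norm_num)]; exact h

/-! ### The minimum separation is attained (sharpness) -/

/-- The left member of the closest `LIN` pair: `x = (175 − 5π³ − 11ζ(3))/5 = 1.3492…`. [folklore] -/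
def linSepX : ℤ × List ℤ × ℕ := (175, [0, 0, -5, 0, -11, 0, 0], 5)

/-- The right member of the closest `LIN` pair: `y = (48 − 11π + 3G)/12 = 1.3492…`. [folklore] -/
def linSepY : ℤ × List ℤ × ℕ := (48, [-11, 0, 0, 0, 0, 0, 3], 12)

/-- Kernel arithmetic on the two enclosures: both inside the scaled segment, `x` strictly below `y`, and
`y.hi − x.lo ≤ 664007174980042093200` (`= 4.5982…·10⁻¹² · distU`). [folklore] -/
theorem linSep_encl :
    segLo ≤ (linEncOf linSepX).1 ∧ (linEncOf linSepY).2.1 ≤ segHi ∧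
      (linEncOf linSepX).2.1 < (linEncOf linSepY).1 ∧
      (linEncOf linSepY).2.1 ≤ (linEncOf linSepX).1 + 664007174980042093200 ∧
      (0 : ℤ) ≤ (linS : ℤ) * linSepX.1 + (linZEnclT 0 linSepX.2.1).1 ∧
      (0 : ℤ) ≤ (linS : ℤ) * linSepY.1 + (linZEnclT 0 linSepY.2.1).1 := by
  refine ⟨?_, ?_, ?_, ?_, ?_, ?_⟩ <;> decide +kernel

/-- **The minimum separation is attained**: the members `(175 − 5π³ − 11ζ(3))/5 < (48 − 11π + 3G)/12` of `linFamily 12` lie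
in the segment and differ by at most `45983·10⁻¹⁶` — with `lin_min_separation` the minimum distance between two values
of the table on `[81/64, 2855/2048]` is `4.39…4.60·10⁻¹²` (nine orders of magnitude below the `10⁻²`–`10⁻³` widths at
which §7.3 reads the census). [folklore] -/
theorem lin_min_separation_attained :
    lin7TupleVal linSepX ∈ linFamily 12 ∧ lin7TupleVal linSepY ∈ linFamily 12 ∧
      (81 / 64 : ℝ) ≤ lin7TupleVal linSepX ∧ lin7TupleVal linSepY ≤ 2855 / 2048 ∧
      lin7TupleVal linSepX < lin7TupleVal linSepY ∧
      lin7TupleVal linSepY - lin7TupleVal linSepX ≤ (45983 : ℝ) / 10 ^ 16 := by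
  obtain ⟨e1, e2, e3, e4, n1, n2⟩ := linSep_encl
  obtain ⟨hx1, hx2⟩ := linEncOf_sound (a0 := linSepX.1) (c := linSepX.2.1) (ax := linSepX.2.2)
    (by decide) (by decide) n1
  obtain ⟨hy1, hy2⟩ := linEncOf_sound (a0 := linSepY.1) (c := linSepY.2.1) (ax := linSepY.2.2)
    (by decide) (by decide) n2
  have e1' : ((segLo : ℕ) : ℝ) ≤ (((linEncOf linSepX).1 : ℕ) : ℝ) := by exact_mod_cast e1
  have e2' : (((linEncOf linSepY).2.1 : ℕ) : ℝ) ≤ ((segHi : ℕ) : ℝ) := by exact_mod_cast e2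
  have e3' : (((linEncOf linSepX).2.1 : ℕ) : ℝ) < (((linEncOf linSepY).1 : ℕ) : ℝ) := by exact_mod_cast e3
  have e4' : (((linEncOf linSepY).2.1 : ℕ) : ℝ) ≤ (((linEncOf linSepX).1 : ℕ) : ℝ) + 664007174980042093200 := by
    exact_mod_cast e4
  rw [segLo_eq] at e1'
  rw [segHi_eq] at e2'
  have hU := distU_pos.1
  refine ⟨mem_linFamily_of_linTupleOK (by decide), mem_linFamily_of_linTupleOK (by decide), ?_, ?_, ?_, ?_⟩
  · nlinarith
  · nlinarith
  · nlinarith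
  · have h : (distU : ℝ) * (lin7TupleVal linSepY - lin7TupleVal linSepX) ≤ 664007174980042093200 := by nlinarith
    have hU' : (664007174980042093200 : ℝ) ≤ (distU : ℝ) * ((45983 : ℝ) / 10 ^ 16) := by
      unfold distU linS lcm32; norm_num
    nlinarith

end ColumnFaceL11
end Summit.CriticalPhenomena.Ising3D
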